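import Summits.NavierStokesRegularity.NavierStokesRegularity.Theses.AxisymmetricExtremality
import Summits.NavierStokesRegularity.NavierStokesRegularity.Theorems.AxisymmetricExtremalityPFoldToAxisymmetric
import Summits.NavierStokesRegularity.NavierStokesRegularity.Theorems.MinimalDatumPFold.Negative.VacuityAndLoadBearing

/-!
# Evidence (lead c3): relative to crux #3 `AxisymmetricKatoGlobal`, crux #2 `MinimalDatumPFold` IS the summit

Kernel-check of item 3 of `Lines/Sketch.dead.md`: over the tree (route `closes` + the PROVED sibling crux
`PFoldToAxisymmetric` + the vacuity certificate p158786), `AxisymmetricKatoGlobal → (MinimalDatumPFold ↔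
NavierStokesRegularity)`. Not proposed (gate hangs on types naming the crux decl, cdisprove OPS note); evidence only.
-/

set_option linter.dupNamespace false

namespace Summit.NavierStokesRegularity.NavierStokesRegularity.Cruxes.MinimalDatumPFold.LeadC3

open Summit.NavierStokesRegularity.NavierStokesRegularity.Theses.AxisymmetricExtremality
open Summit.NavierStokesRegularity.NavierStokesRegularity.Theorems

/-- Relative to AX_H (crux #3) the crux `MinimalDatumPFold` is equivalent to the summit statement: the
route's two open cruxes are jointly Clay (A) itself. [folklore] -/
theorem minimalDatumPFold_iff_summit_of_axisymmetricKatoGlobal (h₃ : AxisymmetricKatoGlobal) :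
    MinimalDatumPFold ↔ NavierStokesRegularity :=
  ⟨fun h₂ => closes h₂ axisymmetricExtremality_pFoldToAxisymmetric_proof h₃,
   fun hS => MinimalDatumPFold.Negative.cruxBody_of_navierStokesRegularity hS⟩

/-- Unconditionally: the summit implies the crux (vacuity), and the crux together with AX_H implies the
summit (the route's assembly with the proved `PFoldToAxisymmetric`). [folklore] -/
theorem summit_iff_cruxes : NavierStokesRegularity ↔ (MinimalDatumPFold ∧ (AxisymmetricKatoGlobal ∨ NavierStokesRegularity)) :=
  ⟨fun hS => ⟨MinimalDatumPFold.Negative.cruxBody_of_navierStokesRegularity hS, Or.inr hS⟩,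
   fun ⟨h₂, h⟩ => h.elim (fun h₃ => closes h₂ axisymmetricExtremality_pFoldToAxisymmetric_proof h₃) id⟩

end Summit.NavierStokesRegularity.NavierStokesRegularity.Cruxes.MinimalDatumPFold.LeadC3
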